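import Summits.RiemannHypothesis.RiemannHypothesis.Theorems.EtaLeadingQuarterSecondMomentZerosZones
import HarnessLib

/-!
# The second moment of the sharp eta vector at the zeros, zero side IX: summing the engine error
(route EtaLeadingQuarter, item `EtaLeadingSecondMoment`, stmt-RiemannHypothesis-21791)

`γ_n = zetaOrdinate n`, `N(T) = zetaZeroCount T`, `y_n = γ_n/(πM)`, `d_n = |y_n − round y_n|`. The AFE
engine at the zero `1/2 + iγ_n` (sibling files) has an error of the shape
`E_n ≤ p + 1_{d_n ≤ η} · q (M/γ_n)^{1/2}` with `p ≍ (log M + 1/η) M^{-1/2}` (off the transition zones)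
and an absolute `q` (inside them). `error_sum_le`: for `M ≥ 1260`, `T₂ ≥ 4⌊M/2⌋`, `0 < η ≤ 1/2`,
`M ∑_{N(4⌊M/2⌋) ≤ n < N(T₂)} E_n²/γ_n² ≤ 2p² M G(4⌊M/2⌋) + 2q² A log(T₂ + πM + 3)(2η + 1/M)`
(`G = SchoenfeldBound.Gtail`, `A` the local zero density; tree `Zeros.sum_filter_inv_sq_le_Gtail`,
`Zeros.inZone_le`). The first term is `O_η((log M)³/M)`, the second `≈ 6 q² A η log M`: choosing
`η ≍ ε` makes the whole error `≤ ε log M` eventually. RH-free. Nothing here bears on the truth of RH.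
-/

noncomputable section

open Real Finset Filter Topology

set_option linter.dupNamespace false  -- the mandated namespace repeats `RiemannHypothesis`

namespace Summit.RiemannHypothesis.RiemannHypothesis.Theorems.EtaLeadingQuarter.Zeros

open Literature.NumberTheory.LFunctions SchoenfeldBound

/-- **Summing the engine error over the zeros.** For `M ≥ 1260`, `T₂ ≥ 4⌊M/2⌋`, `0 < η ≤ 1/2`,
`0 ≤ E_n ≤ p + 1_{d_n ≤ η} q √(M/γ_n)` on `N(4⌊M/2⌋) ≤ n < N(T₂)`:
`M ∑ E_n²/γ_n² ≤ 2 p² M G(4⌊M/2⌋) + 2 q² A log(T₂ + πM + 3) (2η + 1/M)`. [folklore] -/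
theorem error_sum_le {A : ℝ} (hA0 : 0 ≤ A)
    (hA : ∀ t : ℝ, 0 ≤ t → (zetaZeroCount (t + 1) : ℝ) - zetaZeroCount t ≤ A * Real.log (t + 2))
    {M : ℕ} (hM : 1260 ≤ M) {T₂ : ℝ} (hT₂ : 4 * ((M / 2 : ℕ) : ℝ) ≤ T₂) {η p q : ℝ} (hη0 : 0 < η)
    (hη : η ≤ 1 / 2) (E : ℕ → ℝ)
    (hE : ∀ n ∈ Finset.Ico (zetaZeroCount (4 * ((M / 2 : ℕ) : ℝ))) (zetaZeroCount T₂),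
      0 ≤ E n ∧ E n ≤ p + (if |zetaOrdinate n / (π * M) - round (zetaOrdinate n / (π * M))| ≤ η then
        q * Real.sqrt (M / zetaOrdinate n) else 0)) :
    (M : ℝ) * ∑ n ∈ Finset.Ico (zetaZeroCount (4 * ((M / 2 : ℕ) : ℝ))) (zetaZeroCount T₂),
        E n ^ 2 / zetaOrdinate n ^ 2 ≤
      2 * p ^ 2 * ((M : ℝ) * Gtail (4 * ((M / 2 : ℕ) : ℝ))) +
        2 * q ^ 2 * (A * Real.log (T₂ + π * M + 3) * (2 * η + 1 / M)) := by
  classical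
  set Tlo : ℝ := 4 * ((M / 2 : ℕ) : ℝ) with hTlo
  set S := Finset.Ico (zetaZeroCount Tlo) (zetaZeroCount T₂) with hS
  have hπ := Real.pi_gt_three
  have hπ4 := Real.pi_lt_d2
  have hM1 : 1 ≤ M := by omega
  have hMr : (1260 : ℝ) ≤ M := by exact_mod_cast hM
  have hMpos : (0 : ℝ) < M := by linarith
  have hK : (630 : ℝ) ≤ ((M / 2 : ℕ) : ℝ) := by exact_mod_cast (show 630 ≤ M / 2 by omega)
  have hK2 : 2 * ((M / 2 : ℕ) : ℝ) ≥ (M : ℝ) - 1 := by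
    have : 2 * (M / 2) + 1 ≥ M := by omega
    have : ((2 * (M / 2) + 1 : ℕ) : ℝ) ≥ (M : ℝ) := by exact_mod_cast this
    push_cast at this; linarith
  have hTlo1 : 2516 < Tlo := by rw [hTlo]; linarith
  have hTloM : π * M / 2 ≤ Tlo := by rw [hTlo]; nlinarith
  have hT₂0 : 0 ≤ T₂ := by linarith
  -- membership facts
  have hmem : ∀ n ∈ S, Tlo < zetaOrdinate n ∧ n < zetaZeroCount T₂ ∧ 1 / 2 ≤ zetaOrdinate n / (π * M) := by
    intro n hn
    rw [hS, Finset.mem_Ico] at hn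
    have h1 : Tlo < zetaOrdinate n := Montgomery.lt_zetaOrdinate_iff.2 hn.1
    refine ⟨h1, hn.2, ?_⟩
    rw [le_div_iff₀ (by positivity)]
    linarith
  -- pointwise: `E² ≤ 2p² + 2·1_{zone} q² M/γ`
  have hpt : ∀ n ∈ S, E n ^ 2 / zetaOrdinate n ^ 2 ≤
      2 * p ^ 2 * (1 / zetaOrdinate n ^ 2) +
        2 * q ^ 2 * (if 1 / 2 ≤ zetaOrdinate n / (π * M) ∧
          |zetaOrdinate n / (π * M) - round (zetaOrdinate n / (π * M))| ≤ η then
            (M : ℝ) / zetaOrdinate n ^ 3 else 0) := by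
    intro n hn
    obtain ⟨hE0, hEle⟩ := hE n hn
    obtain ⟨-, -, hy⟩ := hmem n hn
    have hγ : 0 < zetaOrdinate n := zetaOrdinate_pos_holds n
    have hγ2 : 0 < zetaOrdinate n ^ 2 := by positivity
    by_cases hz : |zetaOrdinate n / (π * M) - round (zetaOrdinate n / (π * M))| ≤ η
    · rw [if_pos hz] at hEle
      rw [if_pos ⟨hy, hz⟩]
      have hsq : E n ^ 2 ≤ 2 * p ^ 2 + 2 * (q * Real.sqrt (M / zetaOrdinate n)) ^ 2 := by
        nlinarith [sq_nonneg (p - q * Real.sqrt (M / zetaOrdinate n)), pow_le_pow_left₀ hE0 hEle 2]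
      rw [mul_pow, Real.sq_sqrt (by positivity)] at hsq
      rw [div_le_iff₀ hγ2]
      have e : (2 * p ^ 2 * (1 / zetaOrdinate n ^ 2) + 2 * q ^ 2 * ((M : ℝ) / zetaOrdinate n ^ 3)) *
          zetaOrdinate n ^ 2 = 2 * p ^ 2 + 2 * (q ^ 2 * ((M : ℝ) / zetaOrdinate n)) := by
        field_simp
      rw [e]
      exact hsq
    · rw [if_neg hz, add_zero] at hEle
      have hsq : E n ^ 2 ≤ p ^ 2 := pow_le_pow_left₀ hE0 hEle 2
      have h0 : 0 ≤ 2 * q ^ 2 * (if 1 / 2 ≤ zetaOrdinate n / (π * M) ∧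
          |zetaOrdinate n / (π * M) - round (zetaOrdinate n / (π * M))| ≤ η then
            (M : ℝ) / zetaOrdinate n ^ 3 else 0) := by
        split_ifs <;> positivity
      have h1 : E n ^ 2 / zetaOrdinate n ^ 2 ≤ 2 * p ^ 2 * (1 / zetaOrdinate n ^ 2) := by
        rw [div_le_iff₀ hγ2]
        have e : 2 * p ^ 2 * (1 / zetaOrdinate n ^ 2) * zetaOrdinate n ^ 2 = 2 * p ^ 2 := by field_simp
        rw [e]; nlinarith [sq_nonneg p]
      linarith
  -- the two sums
  have hsum1 : ∑ n ∈ S, 1 / zetaOrdinate n ^ 2 ≤ Gtail Tlo := by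
    have hsub : S ⊆ (Finset.range (zetaZeroCount T₂)).filter (fun n ↦ Tlo ≤ zetaOrdinate n) := by
      intro n hn
      obtain ⟨h1, h2, -⟩ := hmem n hn
      rw [Finset.mem_filter, Finset.mem_range]
      exact ⟨h2, h1.le⟩
    exact (Finset.sum_le_sum_of_subset_of_nonneg hsub fun n _ _ ↦ by positivity).trans
      (sum_filter_inv_sq_le_Gtail hTlo1 _)
  have hsum2 : ∑ n ∈ S, (if 1 / 2 ≤ zetaOrdinate n / (π * M) ∧
        |zetaOrdinate n / (π * M) - round (zetaOrdinate n / (π * M))| ≤ η then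
          (M : ℝ) / zetaOrdinate n ^ 3 else 0) ≤
      A * Real.log (T₂ + π * M + 3) * (2 * η / M + 1 / (M : ℝ) ^ 2) := by
    rw [← Finset.sum_filter]
    have hsub : S.filter (fun n ↦ 1 / 2 ≤ zetaOrdinate n / (π * M) ∧
        |zetaOrdinate n / (π * M) - round (zetaOrdinate n / (π * M))| ≤ η) ⊆
        (Finset.range (zetaZeroCount T₂)).filter (fun n ↦ 1 / 2 ≤ zetaOrdinate n / (π * M) ∧
          |zetaOrdinate n / (π * M) - round (zetaOrdinate n / (π * M))| ≤ η) := by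
      intro n hn
      rw [Finset.mem_filter] at hn ⊢
      exact ⟨Finset.mem_range.2 (hmem n hn.1).2.1, hn.2⟩
    refine (Finset.sum_le_sum_of_subset_of_nonneg hsub fun n _ _ ↦ ?_).trans
      (inZone_le hA0 hA hM1 hη0.le hη hT₂0)
    have := zetaOrdinate_pos_holds n
    positivity
  -- combine
  have hG0 : 0 ≤ Gtail Tlo := le_trans (Finset.sum_nonneg fun n _ ↦ by positivity) hsum1
  have hL0 : 0 ≤ Real.log (T₂ + π * M + 3) := Real.log_nonneg (by nlinarith)
  calc (M : ℝ) * ∑ n ∈ S, E n ^ 2 / zetaOrdinate n ^ 2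
      ≤ (M : ℝ) * ∑ n ∈ S, (2 * p ^ 2 * (1 / zetaOrdinate n ^ 2) +
          2 * q ^ 2 * (if 1 / 2 ≤ zetaOrdinate n / (π * M) ∧
            |zetaOrdinate n / (π * M) - round (zetaOrdinate n / (π * M))| ≤ η then
              (M : ℝ) / zetaOrdinate n ^ 3 else 0)) :=
        mul_le_mul_of_nonneg_left (Finset.sum_le_sum hpt) hMpos.le
    _ = (M : ℝ) * (2 * p ^ 2 * ∑ n ∈ S, 1 / zetaOrdinate n ^ 2 +
          2 * q ^ 2 * ∑ n ∈ S, (if 1 / 2 ≤ zetaOrdinate n / (π * M) ∧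
            |zetaOrdinate n / (π * M) - round (zetaOrdinate n / (π * M))| ≤ η then
              (M : ℝ) / zetaOrdinate n ^ 3 else 0)) := by
        rw [Finset.sum_add_distrib, Finset.mul_sum, Finset.mul_sum]
    _ ≤ (M : ℝ) * (2 * p ^ 2 * Gtail Tlo +
          2 * q ^ 2 * (A * Real.log (T₂ + π * M + 3) * (2 * η / M + 1 / (M : ℝ) ^ 2))) := by
        gcongr
    _ = 2 * p ^ 2 * ((M : ℝ) * Gtail Tlo) +
          2 * q ^ 2 * (A * Real.log (T₂ + π * M + 3) * (2 * η + 1 / M)) := by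
        field_simp

end Summit.RiemannHypothesis.RiemannHypothesis.Theorems.EtaLeadingQuarter.Zeros

end
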